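import Mathlib
import Summits.NavierStokesRegularity.NavierStokesRegularity.Theorems.EulerZoomLiouvillePowerGaugeEulerLiouvilleHoopCircleAvgCalculus
import Summits.NavierStokesRegularity.NavierStokesRegularity.Theorems.EulerZoomLiouvillePowerGaugeEulerLiouvilleHoopCutSelection
import HarnessLib

/-!
# R51 plate t54-LAW-CORE, part 1: TOOLS for the ridge-run energy law (cuts, ridge lower bound, cap-cost square roots, the scalar bookkeeping)
# (nsreg-p2 ROUND-51 §2/§7, key nsreg-p2 g41 05:02:22Z → seat ns-sfl-p1 g8; `--supports stmt-NavierStokesRegularity-19832 --as helper`)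

* `solidCyl_mono`, `setIntegral_frobeniusNormSq_solidCyl_mono` — sub-cylinders carry less Frobenius energy;
* `exists_cut_le` — A CUT IN A COLLAR: `[a, a+ℓ] ⊆ [s₁, s₂]` contains a height with disc energy `≤ ℓ⁻¹ ∫_{solidCyl s₁ s₂ T₀}|DV|_F²`
  (`HoopCore.cutSelection`, p697270);
* `mul_le_integral_axisPressureDrop` — ridge lower bound `m(σ₂−σ₁) ≤ ∫_{σ₁}^{σ₂}(P(σe_Z) − ⟨P⟩_θ(σ,T₀))dσ`;
* `abs_integral_discMass_div_le` — the disc-mass quotient integral of the NET law is `≤ 2T₀²S` under the cap-cost bound (no integrability needed);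
* `sqrt_capCost_le` — `√(2w² + D/π) ≤ √2·w + rR` when `D ≤ πr²R²`;
* `ridgeRun_bookkeeping` — THE SCALAR BOOKKEEPING ÷ `2πR²T₀` of the NET law with every term bounded: with slack `sl = Λμ − (8ν²+14γν) > 0` and the
  choices `2θΛμ ≤ sl/4`, `(4+K)r ≤ sl/4` (`K = 4√2(γ+ν)+4γ`), `ε₀Λ/π ≤ sl/8`, `6(√2ν+r) ≤ (sl/8)R`, the assumption `E < ε₀R²L` is absurd.

HONEST FRAMING: class-free calculus/arithmetic tools; nothing about the crux E (19832 OPEN) or NS regularity is proved here. [nsreg-p2 R51 §2; folklore]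
-/

noncomputable section

set_option linter.dupNamespace false

open MeasureTheory Set Filter Topology Metric Function
open scoped RealInnerProductSpace Topology Interval

namespace Summit.NavierStokesRegularity.NavierStokesRegularity.Theorems.PowerGaugeEulerLiouville

open Literature.Analysis Literature.Analysis.FluidPDE

namespace HoopCore

/-! ## Tools -/

/-- Solid cylinders are monotone in the height window. [folklore] -/
theorem solidCyl_mono {s₁ s₂ a b : ℝ} (h₁ : s₁ ≤ a) (h₂ : b ≤ s₂) (T₀ : ℝ) : solidCyl a b T₀ ⊆ solidCyl s₁ s₂ T₀ :=
  fun _ hy => ⟨h₁.trans hy.1, hy.2.1.trans h₂, hy.2.2⟩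

/-- The Frobenius energy of a sub-cylinder is at most that of the cylinder (`V ∈ C¹`). [folklore] -/
theorem setIntegral_frobeniusNormSq_solidCyl_mono {V : EuclideanSpace ℝ (Fin 3) → EuclideanSpace ℝ (Fin 3)} (hV : ContDiff ℝ 1 V)
    {s₁ s₂ a b : ℝ} (h₁ : s₁ ≤ a) (h₂ : b ≤ s₂) (T₀ : ℝ) :
    ∫ y in solidCyl a b T₀, frobeniusNormSq (fderiv ℝ V y) ≤ ∫ y in solidCyl s₁ s₂ T₀, frobeniusNormSq (fderiv ℝ V y) :=
  setIntegral_mono_set (integrableOn_frobeniusNormSq_fderiv_solidCyl hV s₁ s₂ T₀)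
    (Eventually.of_forall fun _ => frobeniusNormSq_nonneg _) (solidCyl_mono h₁ h₂ T₀).eventuallyLE

/-- **A cut in a collar**: for `C¹ V`, a collar `[a, a+ℓ] ⊆ [s₁, s₂]` (`ℓ > 0`, `T₀ > 0`) contains a height whose disc energy is at most
`ℓ⁻¹ · ∫_{solidCyl s₁ s₂ T₀} |DV|_F²` (`cutSelection` + monotonicity). [nsreg-p2 R51 §2; folklore] -/
theorem exists_cut_le {V : EuclideanSpace ℝ (Fin 3) → EuclideanSpace ℝ (Fin 3)} (hV : ContDiff ℝ 1 V) {s₁ s₂ a ℓ T₀ : ℝ}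
    (h₁ : s₁ ≤ a) (hℓ : 0 < ℓ) (h₂ : a + ℓ ≤ s₂) (hT₀ : 0 < T₀) :
    ∃ σ ∈ Icc a (a + ℓ), (∫ z in closedBall (0 : EuclideanSpace ℝ (Fin 2)) T₀, frobeniusNormSq (fderiv ℝ V (liftAt σ z)))
      ≤ (1 / ℓ) * ∫ y in solidCyl s₁ s₂ T₀, frobeniusNormSq (fderiv ℝ V y) := by
  obtain ⟨σ, hσ, hle⟩ := cutSelection V a ℓ T₀ hℓ hT₀ hV
  exact ⟨σ, hσ, hle.trans (mul_le_mul_of_nonneg_left (setIntegral_frobeniusNormSq_solidCyl_mono hV h₁ h₂ T₀)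
    (by positivity))⟩

/-- **Ridge lower bound for the axis pressure drop integral**: if `m ≤ P(σe_Z) − ⟨P⟩_θ(σ,T₀)` on `[σ₁, σ₂]` (`P` continuous), then
`m(σ₂ − σ₁) ≤ ∫_{σ₁}^{σ₂} (P(σe_Z) − ⟨P⟩_θ(σ,T₀)) dσ`. [folklore] -/
theorem mul_le_integral_axisPressureDrop {P : EuclideanSpace ℝ (Fin 3) → ℝ} (hP : Continuous P) {σ₁ σ₂ T₀ m : ℝ} (hle : σ₁ ≤ σ₂)
    (h : ∀ σ ∈ Icc σ₁ σ₂, m ≤ P (σ • eZ) - circleAvg P σ T₀) :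
    m * (σ₂ - σ₁) ≤ ∫ σ in σ₁..σ₂, (P (σ • eZ) - circleAvg P σ T₀) := by
  have hc : Continuous fun σ : ℝ => P (σ • eZ) - circleAvg P σ T₀ :=
    (hP.comp (continuous_id.smul continuous_const)).sub (continuous_circleAvg_height hP T₀)
  have h1 := intervalIntegral.integral_mono_on hle (intervalIntegrable_const (μ := volume) (c := m))
    (hc.intervalIntegrable (μ := volume) σ₁ σ₂) h
  rwa [intervalIntegral.integral_const, smul_eq_mul, mul_comm] at h1

/-- The disc-mass quotient integral of the NET law is bounded by the cap cost: if `|dm(σᵢ,t)| ≤ t√t√(T₀/3)·Sᵢ` on `(0, T₀]` (`i = 1,2`),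
`Sᵢ ≤ S`, `0 < T₀`, then `|∫₀^{T₀} (dm(σ₁,t) − dm(σ₂,t))/t dt| ≤ 2T₀²S` (no integrability needed). [folklore] -/
theorem abs_integral_discMass_div_le {f g : ℝ → ℝ} {T₀ S₁ S₂ S : ℝ} (hT₀ : 0 < T₀)
    (hf : ∀ t ∈ Ioc 0 T₀, |f t| ≤ t * Real.sqrt t * Real.sqrt (T₀ / 3) * S₁)
    (hg : ∀ t ∈ Ioc 0 T₀, |g t| ≤ t * Real.sqrt t * Real.sqrt (T₀ / 3) * S₂)
    (h₁ : S₁ ≤ S) (h₂ : S₂ ≤ S) (hS₁ : 0 ≤ S₁) (hS₂ : 0 ≤ S₂) :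
    |∫ t in (0 : ℝ)..T₀, (f t - g t) / t| ≤ 2 * T₀ ^ 2 * S := by
  have hb : ∀ t ∈ Ι (0 : ℝ) T₀, ‖(f t - g t) / t‖ ≤ 2 * T₀ * S := by
    intro t ht
    rw [uIoc_of_le hT₀.le] at ht
    have ht0 : 0 < t := ht.1
    have hst : Real.sqrt t * Real.sqrt (T₀ / 3) ≤ T₀ := by
      have h1 : Real.sqrt t ≤ Real.sqrt T₀ := Real.sqrt_le_sqrt ht.2
      have h2 : Real.sqrt (T₀ / 3) ≤ Real.sqrt T₀ := Real.sqrt_le_sqrt (by linarith)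
      calc Real.sqrt t * Real.sqrt (T₀ / 3) ≤ Real.sqrt T₀ * Real.sqrt T₀ :=
            mul_le_mul h1 h2 (Real.sqrt_nonneg _) (Real.sqrt_nonneg _)
        _ = T₀ := Real.mul_self_sqrt hT₀.le
    rw [Real.norm_eq_abs, abs_div, abs_of_pos ht0, div_le_iff₀ ht0]
    have hft := hf t ht
    have hgt := hg t ht
    have e1 : t * Real.sqrt t * Real.sqrt (T₀ / 3) * S₁ = t * (Real.sqrt t * Real.sqrt (T₀ / 3)) * S₁ := by ring
    have e2 : t * Real.sqrt t * Real.sqrt (T₀ / 3) * S₂ = t * (Real.sqrt t * Real.sqrt (T₀ / 3)) * S₂ := by ring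
    rw [e1] at hft
    rw [e2] at hgt
    have k1 : t * (Real.sqrt t * Real.sqrt (T₀ / 3)) * S₁ ≤ t * T₀ * S :=
      mul_le_mul (mul_le_mul_of_nonneg_left hst ht0.le) h₁ hS₁ (by positivity)
    have k2 : t * (Real.sqrt t * Real.sqrt (T₀ / 3)) * S₂ ≤ t * T₀ * S :=
      mul_le_mul (mul_le_mul_of_nonneg_left hst ht0.le) h₂ hS₂ (by positivity)
    calc |f t - g t| ≤ |f t| + |g t| := abs_sub _ _
      _ ≤ t * T₀ * S + t * T₀ * S := add_le_add (hft.trans k1) (hgt.trans k2)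
      _ = 2 * T₀ * S * t := by ring
  have h := intervalIntegral.norm_integral_le_of_norm_le_const hb
  rw [Real.norm_eq_abs, sub_zero, abs_of_pos hT₀] at h
  calc |∫ t in (0 : ℝ)..T₀, (f t - g t) / t| ≤ 2 * T₀ * S * T₀ := h
    _ = 2 * T₀ ^ 2 * S := by ring

/-- The cap-cost square root is controlled linearly: `√(2w² + D/π) ≤ √2·w + rR` when `D ≤ πr²R²` (`w, r, R ≥ 0`). [folklore] -/
theorem sqrt_capCost_le {w D r R : ℝ} (hw : 0 ≤ w) (hD0 : 0 ≤ D) (hD : D ≤ Real.pi * r ^ 2 * R ^ 2) (hr : 0 ≤ r) (hR : 0 ≤ R) :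
    Real.sqrt (2 * w ^ 2 + D / Real.pi) ≤ Real.sqrt 2 * w + r * R := by
  have hπ := Real.pi_pos
  -- `√(a + b) ≤ √a + √b` (also `Literature.NumberTheory.LFunctions.MRT2015.sqrt_add_le_sqrt_add_sqrt`; two lines here to keep imports light)
  have h1 : Real.sqrt (2 * w ^ 2 + D / Real.pi) ≤ Real.sqrt (2 * w ^ 2) + Real.sqrt (D / Real.pi) := by
    have ha : (0 : ℝ) ≤ 2 * w ^ 2 := by positivity
    have hb : (0 : ℝ) ≤ D / Real.pi := by positivity
    rw [Real.sqrt_le_left (add_nonneg (Real.sqrt_nonneg _) (Real.sqrt_nonneg _))]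
    nlinarith [Real.sq_sqrt ha, Real.sq_sqrt hb, Real.sqrt_nonneg (2 * w ^ 2), Real.sqrt_nonneg (D / Real.pi)]
  have h2 : Real.sqrt (2 * w ^ 2) = Real.sqrt 2 * w := by
    rw [Real.sqrt_mul (by norm_num : (0 : ℝ) ≤ 2), Real.sqrt_sq hw]
  have h3 : Real.sqrt (D / Real.pi) ≤ r * R := by
    rw [Real.sqrt_le_left (by positivity), div_le_iff₀ hπ]
    linarith
  linarith [h1, h2, h3]

/-! ## The scalar bookkeeping -/

/-- **THE BOOKKEEPING ÷ `2πR²T₀`** (pure real arithmetic; `s = √2` enters only through `s² = 2`, `s ≤ 3/2`): the NET law on the inner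
segment with every term bounded (`hMAIN`), `L ≥ ΛT₀`, `T₀ ≤ 1`, `E < ε₀R²L` and the choices of `θ, r, ε₀, R` against the slack
`sl = Λμ − (8ν² + 14γν) > 0` are contradictory (`Λμ − 3sl/8 ≤ ΛA ≤ Λμ − 5sl/8`, `A = μ(1−2θ) − ε₀/π`). [nsreg-p2 R51 §2; folklore] -/
theorem ridgeRun_bookkeeping {Λ μ ν γ s sl θ r K ε₀ R T₀ L E : ℝ}
    (hs2 : s * s = 2) (hs32 : s ≤ 3 / 2) (hs0 : 0 ≤ s) (hγ0 : 0 < γ) (hγ1 : γ < 1) (hν : 0 ≤ ν) (hΛ : 0 < Λ) (hμ : 0 < μ)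
    (hsl : sl = Λ * μ - (8 * ν ^ 2 + 14 * γ * ν)) (hsl0 : 0 < sl)
    (hθ4 : θ ≤ 1 / 4) (hθsl : 2 * θ * (Λ * μ) ≤ sl / 4)
    (hK : K = 4 * s * (γ + ν) + 4 * γ) (hr0 : 0 < r) (hr1 : r ≤ 1) (hrK : (4 + K) * r ≤ sl / 4)
    (hε₀Λ : ε₀ * Λ / Real.pi ≤ sl / 8)
    (hR0 : 0 < R) (hRQ : 6 * (s * ν + r) ≤ sl / 8 * R) (hT₀ : 0 < T₀) (hT₁ : T₀ ≤ 1) (hLΛ : Λ * T₀ ≤ L)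
    (hcon : E < ε₀ * R ^ 2 * L)
    (hMAIN : 2 * Real.pi * (μ * R ^ 2 * ((1 - 2 * θ) * L))
      ≤ 2 * E + (8 * Real.pi * T₀ * ν ^ 2 * R ^ 2 + 4 * Real.pi * T₀ * r ^ 2 * R ^ 2)
        + 2 * Real.pi * γ * (2 * T₀ ^ 2 * ((s * ν + r) * R)) + 2 * Real.pi * 2 * (2 * T₀ ^ 2 * ((s * ν + r) * R))
        + 2 * Real.pi * (2 * T₀ * ((s * (2 * γ + ν) + r) * R) * ((s * ν + r) * R))
        + 2 * Real.pi * (4 * γ * R * T₀ * ((s * ν + r) * R))) :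
    False := by
  have hπ := Real.pi_pos
  set Sb : ℝ := (s * ν + r) * R with hSbdef
  have hSb0 : 0 ≤ Sb := by positivity
  set A : ℝ := μ * (1 - 2 * θ) - ε₀ / Real.pi with hAdef
  have hA : Λ * A = Λ * μ - 2 * θ * (Λ * μ) - ε₀ * Λ / Real.pi := by simp only [hAdef]; ring
  have hA0 : 0 ≤ A := by
    have h1 : Λ * (ε₀ / Real.pi) ≤ sl / 8 := by
      rw [show Λ * (ε₀ / Real.pi) = ε₀ * Λ / Real.pi by ring]; exact hε₀Λ
    have h2 : sl ≤ Λ * μ := by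
      have : 0 ≤ 8 * ν ^ 2 + 14 * γ * ν := by positivity
      rw [hsl]; linarith
    have h3 : ε₀ / Real.pi ≤ μ / 8 := by
      refine le_of_mul_le_mul_left ?_ hΛ
      linarith
    have h4 : μ * θ ≤ μ * (1 / 4) := mul_le_mul_of_nonneg_left hθ4 hμ.le
    simp only [hAdef]; linarith
  set a : ℝ := 2 * Real.pi * R ^ 2 * T₀ with hadef
  have ha : 0 < a := by positivity
  have hT2 : T₀ ^ 2 ≤ T₀ := by rw [sq]; exact mul_le_of_le_one_right hT₀.le hT₁
  -- the main inequality in the form `a·(ΛA) ≤ a·(main + tail)`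
  have hkey : a * (Λ * A) ≤ a * (4 * ν ^ 2 + 2 * r ^ 2 + 2 * (s * (2 * γ + ν) + r) * (s * ν + r) + 4 * γ * (s * ν + r)
      + (2 * γ + 4) * (s * ν + r) / R) := by
    have h1 : a * (Λ * A) ≤ 2 * Real.pi * R ^ 2 * L * A := by
      have : a * Λ = 2 * Real.pi * R ^ 2 * (Λ * T₀) := by simp only [hadef]; ring
      rw [← mul_assoc, this]
      exact mul_le_mul_of_nonneg_right (mul_le_mul_of_nonneg_left hLΛ (by positivity)) hA0
    have h2 : 2 * Real.pi * R ^ 2 * L * A = 2 * Real.pi * (μ * R ^ 2 * ((1 - 2 * θ) * L)) - 2 * (ε₀ * R ^ 2 * L) := by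
      simp only [hAdef]; field_simp
    have hRne : R ≠ 0 := hR0.ne'
    have h3 : a * (4 * ν ^ 2 + 2 * r ^ 2 + 2 * (s * (2 * γ + ν) + r) * (s * ν + r) + 4 * γ * (s * ν + r)
        + (2 * γ + 4) * (s * ν + r) / R)
        = (8 * Real.pi * T₀ * ν ^ 2 * R ^ 2 + 4 * Real.pi * T₀ * r ^ 2 * R ^ 2)
          + 2 * Real.pi * (2 * T₀ * ((s * (2 * γ + ν) + r) * R) * Sb) + 2 * Real.pi * (4 * γ * R * T₀ * Sb)
          + 2 * Real.pi * γ * (2 * T₀ * Sb) + 2 * Real.pi * 2 * (2 * T₀ * Sb) := by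
      simp only [hadef, hSbdef]; field_simp; ring
    have hTS : 2 * T₀ ^ 2 * Sb ≤ 2 * T₀ * Sb := by
      have : T₀ ^ 2 * Sb ≤ T₀ * Sb := mul_le_mul_of_nonneg_right hT2 hSb0
      linarith
    have h4 : 2 * Real.pi * γ * (2 * T₀ ^ 2 * Sb) ≤ 2 * Real.pi * γ * (2 * T₀ * Sb) :=
      mul_le_mul_of_nonneg_left hTS (by positivity)
    have h5 : 2 * Real.pi * 2 * (2 * T₀ ^ 2 * Sb) ≤ 2 * Real.pi * 2 * (2 * T₀ * Sb) :=
      mul_le_mul_of_nonneg_left hTS (by positivity)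
    rw [h3]
    linarith [h1, h2, hMAIN, hcon, h4, h5]
  have hkey' := le_of_mul_le_mul_left hkey ha
  -- the scalar contradiction
  have hmain : 4 * ν ^ 2 + 2 * r ^ 2 + 2 * (s * (2 * γ + ν) + r) * (s * ν + r) + 4 * γ * (s * ν + r)
      = 8 * ν ^ 2 + 8 * γ * ν + 4 * s * γ * ν + 4 * r ^ 2 + K * r := by
    rw [hK]; linear_combination (2 * (2 * γ + ν) * ν) * hs2
  have hsγν : s * (γ * ν) ≤ 3 / 2 * (γ * ν) := mul_le_mul_of_nonneg_right hs32 (mul_nonneg hγ0.le hν)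
  have hr2 : r ^ 2 ≤ r := by rw [sq]; exact mul_le_of_le_one_right hr0.le hr1
  have htail : (2 * γ + 4) * (s * ν + r) / R ≤ sl / 8 := by
    rw [div_le_iff₀ hR0]
    have : (2 * γ + 4) * (s * ν + r) ≤ 6 * (s * ν + r) := mul_le_mul_of_nonneg_right (by linarith) (by positivity)
    linarith [hRQ]
  rw [hmain] at hkey'
  have hfin : Λ * A ≤ Λ * μ - 5 * sl / 8 := by
    have e1 : 8 * ν ^ 2 + 8 * γ * ν + 4 * s * γ * ν + 4 * r ^ 2 + K * r ≤ 8 * ν ^ 2 + 14 * γ * ν + (4 + K) * r := by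
      linarith [hsγν, hr2]
    have e2 : 8 * ν ^ 2 + 14 * γ * ν = Λ * μ - sl := by rw [hsl]; ring
    linarith [hkey', e1, e2, hrK, htail]
  have hfin' : Λ * μ - 3 * sl / 8 ≤ Λ * A := by rw [hA]; linarith [hθsl, hε₀Λ]
  linarith [hfin, hfin', hsl0]

end HoopCore

end Summit.NavierStokesRegularity.NavierStokesRegularity.Theorems.PowerGaugeEulerLiouville

end
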